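import Literature.Computability.MetaComplexity.HierarchicalParityComb
import HarnessLib

/-!
# Hierarchical parity formulas, III: the combination sequents at every level

Third layer of the depth-dependent bounded-depth Frege upper bound for linear algebra over `𝔽₂`
(`DepthFregeGaussianElimination.lean`): the bounded derivations (`TextbookFrege.BD`) of the
combination sequents

  `comb a T T' j b e e' = ⊢ ¬hp T j b e, ¬hp T' j b e', hp (T ∆ T') j b (e ⊕ e')`

for all levels `j`, blocks `b` and bits `e, e'` (`combS`): level `0` by a truth table over the one
variable of the block; level `j + 1` by instantiating the depth-`15` proof of the skeleton sequent
(`exists_proof_combSkel`, `subst_combSkel`; `substProofBD`) and cutting its `4a` negated children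
facts away against the level-`j` sequents (`elimAllN`). Bookkeeping: `combLines a j` lines
(`= (4a)^j · 2^{O(a)}`), line sizes `≤ combB a j = 2^{O(a)} · hsz a j`, disjunct depth `≤ 2j + 18`.

All statements are proved.

References: N. Galesi, D. Itsykson, A. Riazanov, A. Sofronova, APAL 174 (2023), Lemma 4, §3.1, §4;
J. Håstad, J. ACM 68 (2021), §1.
-/

namespace Literature.Computability.MetaComplexity

open Complexity Complexity.PropForm TextbookFrege KrajicekRamsey Finset Complexity.Stockmeyer

namespace HierParity

variable {a : ℕ}

/-! ### Budgets -/

/-- `hsz` is monotone in the level. [folklore] -/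
theorem hsz_le_succ (a j : ℕ) : hsz a j ≤ hsz a (j + 1) := by
  show hsz a j ≤ 2 ^ a * (a * (hsz a j + 1) + 2) + 1
  have h1 := Nat.one_le_two_pow (n := a)
  rcases Nat.eq_zero_or_pos a with rfl | ha
  · simp
    induction j with
    | zero => simp [hsz]
    | succ j ih => show 2 ^ 0 * (0 * (hsz 0 j + 1) + 2) + 1 ≤ 3; simp
  · calc hsz a j ≤ 1 * (a * (hsz a j + 1) + 2) := by nlinarith
      _ ≤ 2 ^ a * (a * (hsz a j + 1) + 2) := Nat.mul_le_mul_right _ h1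
      _ ≤ _ := Nat.le_succ _

/-- The line-size budget of level `j`. [folklore] -/
def combB (a j : ℕ) : ℕ :=
  skelPS a * hsz a j + (64 * a + 64) * (hsz a j + 4) + 1000

/-- `combB` is monotone in the level. [folklore] -/
theorem combB_le_succ (a j : ℕ) : combB a j ≤ combB a (j + 1) := by
  unfold combB
  have h := hsz_le_succ a j
  have h1 := Nat.mul_le_mul_left (skelPS a) h
  have h2 := Nat.mul_le_mul_left (64 * a + 64) (Nat.add_le_add_right h 4)
  omega

/-- The line count of level `j`. [folklore] -/
def combLines (a : ℕ) : ℕ → ℕ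
  | 0 => 2 ^ 1 * (12 * (100 * (1 + 8) ^ 2) + 50 * (1 + 3 + 3) ^ 2 + 2)
  | j + 1 => skelPS a + 4 * a * (combLines a j + 9 + 50 * (4 * a + 4 + 1) ^ 2 + 2)

/-! ### Facts about the combination formula -/

section CombFacts

variable (a) (T T' : Finset ℕ) (j b : ℕ) (e e' : Bool)

/-- The size of the combination formula. [folklore] -/
theorem size_comb_le : (comb a T T' j b e e').size ≤ 3 * hsz a j + 6 := by
  have h1 := size_hp_le (a := a) T j b e
  have h2 := size_hp_le (a := a) T' j b e'
  have h3 := size_hp_le (a := a) (symmDiff T T') j b (xor e e')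
  simp only [comb, size_disjList_cons, size_disjList_nil, size]
  omega

/-- The disjunct depth of the combination formula. [folklore] -/
theorem dd_comb_le : (comb a T T' j b e e').dd ≤ 2 * j + 4 := by
  rw [comb]
  refine dd_disjList_le fun X hX => ?_
  simp only [List.mem_cons, List.not_mem_nil, or_false] at hX
  rcases hX with rfl | rfl | rfl
  · rw [dd_neg]; have := altDepthAux_hp_le (a := a) T j b e 1; omega
  · rw [dd_neg]; have := altDepthAux_hp_le (a := a) T' j b e' 1; omega
  · have := dd_hp_le (a := a) (symmDiff T T') j b (xor e e'); omega

/-- The disjunct depth of the negated combination formula. [folklore] -/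
theorem dd_neg_comb_le : (neg (comb a T T' j b e e')).dd ≤ 2 * j + 6 := by
  rw [comb]
  refine dd_neg_disjList_le (p := 2 * j + 4) fun X hX => ?_
  simp only [List.mem_cons, List.not_mem_nil, or_false] at hX
  rcases hX with rfl | rfl | rfl
  · rw [dd_neg]; have := altDepthAux_hp_le (a := a) T j b e 1; omega
  · rw [dd_neg]; have := altDepthAux_hp_le (a := a) T' j b e' 1; omega
  · have := dd_hp_le (a := a) (symmDiff T T') j b (xor e e'); omega

variable {a T T' j b e e'}

/-- **The combination formula is a tautology** (semantically, at every level). [folklore] -/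
theorem comb_taut (ha : 0 < a) (τ : ℕ → Bool) :
    ∃ A ∈ [neg (hp a T j b e), neg (hp a T' j b e'), hp a (symmDiff T T') j b (xor e e')],
      A.eval τ = true := by
  by_cases h1 : (hp a T j b e).eval τ = true
  · by_cases h2 : (hp a T' j b e').eval τ = true
    · refine ⟨_, List.mem_cons_of_mem _ (List.mem_cons_of_mem _ List.mem_cons_self), ?_⟩
      rw [eval_hp ha] at h1 h2 ⊢
      rw [cnt_symmDiff, h1, h2, bz_xor]
    · exact ⟨_, List.mem_cons_of_mem _ List.mem_cons_self, by simpa [eval] using h2⟩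
  · exact ⟨_, List.mem_cons_self, by simpa [eval] using h1⟩

end CombFacts

/-! ### Level `0` -/

/-- **Level `0`**: the combination sequent of a single-index block, by a truth table over its one
variable. [cite: GalesiEtAl2023, Lemma 4] -/
theorem combS_zero (ha : 0 < a) (T T' : Finset ℕ) (b : ℕ) (e e' : Bool) {D B : ℕ} (hD : 18 ≤ D)
    (hB : combB a 0 ≤ B) : BD D B (combLines a 0) (comb a T T' 0 b e e') := by
  have hB' : 720 ≤ B := by unfold combB at hB; omega
  have hsz0 : ∀ (U : Finset ℕ) (c : Bool), (hp a U 0 b c).size ≤ 2 := fun U c => size_hp_le U 0 b c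
  refine (tautSeqW [neg (hp a T 0 b e), neg (hp a T' 0 b e'), hp a (symmDiff T T') 0 b (xor e e')]
    [b] (List.nodup_singleton b) (N := 1) (G := 3) (by simp) (by simp) ?_ (comb_taut ha) (q := 6) ?_
    (S₀ := 12) ?_ (by omega) (by omega)).weaken le_rfl (by omega)
  · intro A hA x hx
    rw [List.mem_singleton]
    simp only [List.mem_cons, List.not_mem_nil, or_false] at hA
    rcases hA with rfl | rfl | rfl
    · have h := mem_vars_hp ha T 0 b e (by simpa [PropForm.vars] using hx); simpa using h.2
    · have h := mem_vars_hp ha T' 0 b e' (by simpa [PropForm.vars] using hx); simpa using h.2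
    · have h := mem_vars_hp ha _ 0 b _ hx; simpa using h.2
  · intro A hA
    simp only [List.mem_cons, List.not_mem_nil, or_false] at hA
    rcases hA with rfl | rfl | rfl
    · refine (altDepth_le_dd_succ _).trans ?_
      rw [dd_neg]; have := altDepthAux_hp_le (a := a) T 0 b e 1; omega
    · refine (altDepth_le_dd_succ _).trans ?_
      rw [dd_neg]; have := altDepthAux_hp_le (a := a) T' 0 b e' 1; omega
    · exact (altDepth_hp_le _ _ _ _).trans (by norm_num)
  · have h1 := hsz0 T e; have h2 := hsz0 T' e'; have h3 := hsz0 (symmDiff T T') (xor e e')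
    simp only [msum_cons, msum_nil, size]; omega

/-! ### The induction -/

/-- **The combination sequents at every level.** For `a ≥ 1`, all `T, T'`, every level `j`, block
`b` and bits `e, e'`, the sequent `⊢ ¬hp T j b e, ¬hp T' j b e', hp (T ∆ T') j b (e ⊕ e')` has a
bounded derivation with `≤ combLines a j` lines of disjunct depth `≤ D` (any `D ≥ 2j + 18`) and size
`≤ B` (any `B ≥ combB a j`). [cite: GalesiEtAl2023, §4 (local parity steps), §3.1 (substitution)] -/
theorem combS (ha : 0 < a) (T T' : Finset ℕ) :
    ∀ (j b : ℕ) (e e' : Bool) {D B : ℕ}, 2 * j + 18 ≤ D → combB a j ≤ B →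
      BD D B (combLines a j) (comb a T T' j b e e') := by
  intro j
  induction j with
  | zero => intro b e e' D B hD hB; exact combS_zero ha T T' b e e' (by omega) hB
  | succ j ih =>
    intro b c c' D B hD hB
    -- sizes and depths at the two levels
    have hszj := hsz_le_succ a j
    have hBj : combB a j ≤ B := (combB_le_succ a j).trans hB
    have hB1 : skelPS a * hsz a (j + 1) + (64 * a + 64) * (hsz a (j + 1) + 4) + 1000 ≤ B := hB
    have h2hsz := two_le_hsz a j
    have hoB : 48 * (a * hsz a (j + 1)) + 64 * hsz a (j + 1) + 256 * a + 256 ≤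
        (64 * a + 64) * (hsz a (j + 1) + 4) := by nlinarith
    -- (1) the skeleton, instantiated
    obtain ⟨π, hπ, hπsize⟩ := exists_proof_combSkel (a := a) c c'
    have sub := substProofBD (combSubst a T T' j b) (Zσ := hsz a j) (Tσ := 2 * j + 3)
      size_combSubst_le (by omega) altDepthAux_combSubst_le hπ
    rw [subst_combSkel] at sub
    have sub' : BD D B (skelPS a)
        (disjList (((cfList a).map fun X => neg (X.subst (combSubst a T T' j b))) ++
          [neg (hp a T (j + 1) b c), neg (hp a T' (j + 1) b c'),
            hp a (symmDiff T T') (j + 1) b (xor c c')])) := by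
      refine (sub.weaken (by omega) ?_).mono hπsize
      calc proofSize π * hsz a j ≤ skelPS a * hsz a (j + 1) := Nat.mul_le_mul hπsize hszj
        _ ≤ B := by omega
    -- the pieces of the instantiated sequent
    have hXmem : ∀ x ∈ (cfList a).map (fun X => neg (X.subst (combSubst a T T' j b))),
        ∃ (r : Fin a) (e e' : Bool), x = neg (comb a T T' j (b * a + r) e e') := by
      intro x hx
      obtain ⟨X, hX, rfl⟩ := List.mem_map.1 hx
      obtain ⟨r, e, e', rfl⟩ := mem_cfList hX
      exact ⟨r, e, e', by rw [subst_cfSkel]⟩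
    have hXlen : ((cfList a).map fun X => neg (X.subst (combSubst a T T' j b))).length = 4 * a := by
      rw [List.length_map, length_cfList]
    have hXdd : ∀ x ∈ (cfList a).map (fun X => neg (X.subst (combSubst a T T' j b))), x.dd ≤ 2 * j + 6 := by
      intro x hx
      obtain ⟨r, e, e', rfl⟩ := hXmem x hx
      exact dd_neg_comb_le a T T' j _ e e'
    have hXsize : ∀ x ∈ (cfList a).map (fun X => neg (X.subst (combSubst a T T' j b))),
        x.size + 1 ≤ 3 * hsz a j + 8 := by
      intro x hx
      obtain ⟨r, e, e', rfl⟩ := hXmem x hx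
      have := size_comb_le a T T' j (b * a + r) e e'
      simp only [size]; omega
    have hmsumX : msum ((cfList a).map fun X => neg (X.subst (combSubst a T T' j b))) ≤
        12 * (a * hsz a (j + 1)) + 32 * a := by
      have h := msum_le_length_mul hXsize
      rw [hXlen] at h
      refine h.trans ?_
      have := Nat.mul_le_mul_left a hszj
      nlinarith
    have hL'dd : ∀ X ∈ [neg (hp a T (j + 1) b c), neg (hp a T' (j + 1) b c'),
        hp a (symmDiff T T') (j + 1) b (xor c c')], X.dd ≤ 2 * j + 6 := by
      intro X hX
      simp only [List.mem_cons, List.not_mem_nil, or_false] at hX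
      rcases hX with rfl | rfl | rfl
      · rw [dd_neg]; have := altDepthAux_hp_le (a := a) T (j + 1) b c 1; omega
      · rw [dd_neg]; have := altDepthAux_hp_le (a := a) T' (j + 1) b c' 1; omega
      · have := dd_hp_le (a := a) (symmDiff T T') (j + 1) b (xor c c'); omega
    have hL'msum : msum [neg (hp a T (j + 1) b c), neg (hp a T' (j + 1) b c'),
        hp a (symmDiff T T') (j + 1) b (xor c c')] ≤ 3 * hsz a (j + 1) + 5 := by
      have h1 := size_hp_le (a := a) T (j + 1) b c
      have h2 := size_hp_le (a := a) T' (j + 1) b c'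
      have h3 := size_hp_le (a := a) (symmDiff T T') (j + 1) b (xor c c')
      simp only [msum_cons, msum_nil, size]; omega
    -- (2) the children facts, doubly negated and weakened into place
    have hx : ∀ x ∈ (cfList a).map (fun X => neg (X.subst (combSubst a T T' j b))), ∀ K,
        K <:+ (cfList a).map (fun X => neg (X.subst (combSubst a T T' j b))) →
        BD D B (combLines a j + 9 + 50 * (4 * a + 4 + 1) ^ 2)
          (disjList (neg x :: (K ++ [neg (hp a T (j + 1) b c), neg (hp a T' (j + 1) b c'),
            hp a (symmDiff T T') (j + 1) b (xor c c')]))) := by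
      intro x hx K hK
      obtain ⟨r, e, e', rfl⟩ := hXmem x hx
      have hch := ih (b * a + r) e e' (D := D) (B := B) (by omega) hBj
      have hchsize := size_comb_le a T T' j (b * a + r) e e'
      have hchdd := dd_comb_le a T T' j (b * a + r) e e'
      have hch1 := altDepthAux_le_dd_succ 1 (comb a T T' j (b * a + r) e e')
      have u := unitS hch (by omega) (by omega)
      have nn : BD D B (combLines a j + 3 + 6) (disjList [neg (neg (comb a T T' j (b * a + r) e e'))]) :=
        consNegNegS u (by rw [dd_neg]; omega)
          (by simp only [disjList_nil, dd_neg, altDepthAux_const']; omega) (by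
          simp only [size_disjList_cons, size_disjList_nil]; omega)
      have hKsub : ∀ X ∈ K, X ∈ (cfList a).map (fun X => neg (X.subst (combSubst a T T' j b))) :=
        fun X hX => hK.subset hX
      have hKlen : K.length ≤ 4 * a := by rw [← hXlen]; exact hK.length_le
      have hmK : msum K ≤ 12 * (a * hsz a (j + 1)) + 32 * a :=
        (msum_le_of_sublist hK.sublist).trans hmsumX
      have hL'm := hL'msum
      refine (subsetN (N := 4 * a + 4) nn ?_ (p := 2 * j + 6) ?_ (by omega) ?_ (by simp) ?_).mono (by omega)
      · intro X hX
        rw [List.mem_singleton] at hX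
        rw [hX]; exact List.mem_cons_self
      · intro X hX
        rcases List.mem_cons.1 hX with rfl | hX
        · rw [dd_neg, altDepthAux_one_neg]; omega
        · rcases List.mem_append.1 hX with hX | hX
          · exact hXdd X (hKsub X hX)
          · exact hL'dd X hX
      · simp only [msum_cons, msum_nil, size] at hL'm
        simp only [size_disjList_eq_msum, msum_cons, msum_nil, msum_append, size]
        omega
      · simp only [List.length_cons, List.length_append, List.length_nil]; omega
    -- (3) cut the children facts away
    have hs : 2 * (disjList (((cfList a).map fun X => neg (X.subst (combSubst a T T' j b))) ++
        [neg (hp a T (j + 1) b c), neg (hp a T' (j + 1) b c'),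
          hp a (symmDiff T T') (j + 1) b (xor c c')])).size + 1 ≤ B := by
      rw [size_disjList_eq_msum, msum_append]
      omega
    have fin := elimAllN _ sub' hx hs (N := 4 * a) hXlen.le
    exact fin

end HierParity

end Literature.Computability.MetaComplexity
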